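import Summits.QuantumFields.BalabanUV.Beta.GAN24.CoProjBmDivFree

/-!
# `BalabanUV.Beta.GAN24.CoDressedColumnPairing` — binder row G-an2-4 / (CONV-C), W-slot CT-route «CT-W», the OWNER's `CT-W-DESIGN-v0.md` (R-CT) ∕ word (W6)
# «OFFER WANTED: the generic summation-by-parts identity for a Π_bm-dressed column against a (bi-)stencil leg (`vertexOfK (coDressKBmAt ρ N K) N S = vertexOfK K N S
# − ⟨bmGaugeAt(colH K), div S⟩`-type)», [LEAF02-G51-INTENT1]: **A CO-DRESSED `ℋ`-COLUMN IS THE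
# UNDRESSED ONE GAUGE-TRANSFORMED BY ITS OWN BLOCK-MEAN TREE GAUGE (`colH G = colH K − grad χ`, `χ = bmGaugeAt ρ (colH K N μ y) N` — the W-analogue of CT-3's `T = B + dλ`);
# AND THE PAIRING IDENTITY `vertexOfK G N S = vertexOfK K N S + Σ'_u χ(u) · (div_u S)` — THE DRESSED VERTEX IS THE UNDRESSED ONE PLUS «χ UNDIFFERENTIATED × THE FINE DIVERGENCE OF THE LEG».**

NOT IN PRINT; OUR BOOKKEEPING (G-an2-4 crux team (2), leaf prover `b2b-balaban-gan24-formalise-leaf-02`, gen 51; OWNER gan24-p1 g22 RULING R-gan24p1-g22-1 (W6); journal OFFER O-leaf02-g51-1).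
HONEST FRAMING (cell contract, verbatim): «discharging `BetaPertH` makes Bałaban's UV stability UNCONDITIONAL — a real constructive-QFT result; it is NOT the continuum limit and NOT
the Clay problem.»  HONEST DEPENDENCY (verbatim): «continuum YM on T⁴ ⇐ BetaPertH ∧ nine spine estimates (0/9 proved); BetaPertH ⇐ (D1) ∧ (D4) ∧ CAP+tail; G-an2-4 gates asym, D1 and
NE2/3/4.»  PRIOR ART BY NAME: «the window matrix IS the operator» and the operator form of the dressed column are gan24-p4 g27's `GAN24/AxProjBmWindow`
(`axProjBmAt_eq_coProjBmW'`, `colH_coDressKBmAt_eq_axProjBmAt`; RULINGS-15b of the row owner) — used here BY NAME (leaf-06 g42's PRE-READ P-leaf06g42-1 re-located them);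
what is new is the GRADIENT ∕ DIVERGENCE read-out.  [folklore] lattice bookkeeping over an2's `AxialDressingRooted.coDressKBmAt` ∕ `mem_axial` ∕ `axial_length_le_of_root`,
an4's `OneStepKernelFamily.colH` ∕ `vertexOfK` ∕ `wsum`, `AxialDressing.summable_col_of_decays`, `ExpKernelCalculus.summable_exp_shift'`, all BY NAME;
`d + 1` dimensions, in-block root, `1 ≤ N`; 0 `def`, 0 cited facts, 0 `def … : Prop`, 0 sorry.  NO estimate of Bałaban's; discharges NOTHING of (hW, hWall) — it is the CT-W1 ∕ CT-W2 enabling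
identity of the OWNER's module plan §3; 0 wall binders; NEVER «G-an2-4 closed» as (CONV-C); NOT D1, NOT BetaPertH, NOT continuum, NOT Clay.

## What (`ρ = toSite r`, `r ∈ box (d+1) N`, `1 ≤ N`)
* §2 **`colH_coDressKBmAt_eq_sub_grad`**: `colH (coDressKBmAt ρ N K) N μ y κ u = colH K N μ y κ u − (χ (u + e_κ) − χ u)`, `χ := bmGaugeAt ρ (colH K N μ y) N` — the
  co-dressed column is the undressed one minus an EXACT GRADIENT of a block-mean-normalised tree gauge (read off `AxProjBmWindow.colH_coDressKBmAt_eq_axProjBmAt`).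
* §3 bounds: `abs_list_sum_le_of_forall_abs_le`, **`abs_treeGaugeAt_le`** (`|λ^ρ_A(x)| ≤ (d+1)·N·M` for `|A| ≤ M`, via an2's `mem_axial` + `axial_length_le_of_root`), `abs_blockMeanAt_le`,
  **`abs_bmGaugeAt_le`** (`|χ| ≤ 2(d+1)N·M`); `summable_stencil_slot` (a `LocStencil` leg is summable in its bond slot).
* §4 **`sum_tsum_grad_mul_eq_neg_tsum_mul_div`**: for bounded `χ` and slot-summable `g`, `Σ_κ Σ'_u (χ(u+e_κ) − χ u)·g κ u = −Σ'_u χ u · Σ_κ (g κ u − g κ (u − e_κ))` (lattice summation by parts).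
* §5 **`vertexOfK_coDressKBmAt_eq`**: for a decaying `K` (rate `> 0`) and a `LocStencil` leg `S` (rate `> 0`),
  `vertexOfK (coDressKBmAt ρ N K) N S μ y x z a b = vertexOfK K N S μ y x z a b + Σ'_u χ u · Σ_κ (S κ u x z a b − S κ (u − e_κ) x z a b)` —
  THE DRESSED VERTEX = THE UNDRESSED VERTEX + «χ UNDIFFERENTIATED × THE FINE DIVERGENCE OF THE LEG» (the OWNER's wanted shape; on a Ward-transversal leg the correction VANISHES).
-/

noncomputable section

open Finset
open scoped BigOperators
open Literature.MathematicalPhysics.QuantumFieldTheory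
open Literature.MathematicalPhysics.QuantumFieldTheory.Balaban1983to89
open Literature.MathematicalPhysics.QuantumFieldTheory.Balaban1983to89.Beta
open B12Sec2to5 (l1 l1_nonneg)
open ExpKernelCalculus (MKer Decays summable_exp_shift' l1_sub_symm)
open AffineAveraging (Form0 Form1 box toSite unitVec unitVec_apply blockSum)
open AveragingContours (grad blk axial blk_block)
open AveragingContoursRooted (treeGaugeAt)
open AxialProjector (zsmul_blk_le lt_zsmul_blk_add)
open OneStepResolventKernel (Fib LocStencil wsum)
open OneStepKernelFamily (colH abs_colH_le vertexOfK)
open AxialDressing (summable_col_of_decays)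
open Summit.QuantumFields.BalabanUV.Beta.AxialProjectorBlockMean (blockMeanAt bmGaugeAt axProjBmAt)
open Summit.QuantumFields.BalabanUV.Beta.AxialDressingRooted (coDressKBmAt mem_axial axial_length_le_of_root)
open Summit.QuantumFields.BalabanUV.Beta.GAN24.AxProjBmWindow (colH_coDressKBmAt_eq_axProjBmAt)

namespace Summit.QuantumFields.BalabanUV.Beta.GAN24.CoDressedColumnPairing

variable {d : ℕ}

/-! ## §2 The co-dressed column = the undressed column minus an exact gradient -/

/-- NOT IN PRINT; OUR BOOKKEEPING.  **THE CO-DRESSED COLUMN IS THE UNDRESSED ONE MINUS AN EXACT GRADIENT** (the W-analogue of CT-3's `T = B + dλ`, `ContactCellLetters.legChain_apply_eq`):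
`colH (coDressKBmAt ρ N K) N μ y κ u = colH K N μ y κ u − (χ (u + e_κ) − χ u)`, `χ := bmGaugeAt ρ (colH K N μ y) N`. -/
theorem colH_coDressKBmAt_eq_sub_grad {N : ℕ} (hN : 1 ≤ N) {r : Fin (d + 1) → ℕ} (hr : r ∈ box (d + 1) N) (K : MKer (d + 1) (Fib d)) (μ : Fin (d + 1))
    (y : Fin (d + 1) → ℤ) (κ : Fin (d + 1)) (u : Fin (d + 1) → ℤ) :
    colH (coDressKBmAt (toSite r) N K) N μ y κ u = colH K N μ y κ u
      - (bmGaugeAt (toSite r) (colH K N μ y) N (u + unitVec κ) - bmGaugeAt (toSite r) (colH K N μ y) N u) := by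
  rw [colH_coDressKBmAt_eq_axProjBmAt hN hr K μ y]
  simp only [axProjBmAt, grad, Pi.sub_apply]

/-! ## §3 Bounds: the tree gauge and its block-mean normalisation of a bounded form are bounded; a stencil leg is slot-summable -/

/-- [folklore] A real list with letters bounded by `M` in absolute value has `|sum| ≤ length · M`. -/
theorem abs_list_sum_le_of_forall_abs_le {l : List ℝ} {M : ℝ} (h : ∀ a ∈ l, |a| ≤ M) : |l.sum| ≤ (l.length : ℝ) * M := by
  induction l with
  | nil => simp
  | cons a t ih =>
    simp only [List.sum_cons, List.length_cons, Nat.cast_add, Nat.cast_one]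
    have ha : |a| ≤ M := h a (by simp)
    have ht : |t.sum| ≤ (t.length : ℝ) * M := ih fun b hb => h b (by simp [hb])
    calc |a + t.sum| ≤ |a| + |t.sum| := abs_add_le _ _
      _ ≤ M + (t.length : ℝ) * M := add_le_add ha ht
      _ = ((t.length : ℝ) + 1) * M := by ring

/-- [folklore] **THE ROOTED TREE GAUGE OF A BOUNDED FORM IS BOUNDED**: `|λ^ρ_A(x)| ≤ (d+1)·N·M` (in-block root; letters `±A` by the lead's `mem_axial`, at most `(d+1)N` of them). -/
theorem abs_treeGaugeAt_le {N : ℕ} (hN : 1 ≤ N) {r : Fin (d + 1) → ℕ} (hr : r ∈ box (d + 1) N) {A : Form1 (d + 1) ℝ} {M : ℝ} (hA : ∀ κ w, |A κ w| ≤ M)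
    (x : Fin (d + 1) → ℤ) : |treeGaugeAt (toSite r) A N x| ≤ (((d + 1 : ℕ) : ℝ)) * N * M := by
  have hM : 0 ≤ M := (abs_nonneg _).trans (hA 0 0)
  unfold treeGaugeAt
  have h1 : ∀ a ∈ axial A ((N : ℤ) • blk N x + toSite r) x, |a| ≤ M := by
    intro a ha
    obtain ⟨κ, w, hor⟩ := mem_axial ha
    rcases hor with e | e
    · rw [e]; exact hA κ w
    · rw [e, abs_neg]; exact hA κ w
  have h2 := abs_list_sum_le_of_forall_abs_le h1
  have h3 : ((axial A ((N : ℤ) • blk N x + toSite r) x).length : ℝ) ≤ ((d + 1 : ℕ) : ℝ) * N := by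
    exact_mod_cast axial_length_le_of_root hN hr A x
  calc |(axial A ((N : ℤ) • blk N x + toSite r) x).sum| ≤ ((axial A ((N : ℤ) • blk N x + toSite r) x).length : ℝ) * M := h2
    _ ≤ ((d + 1 : ℕ) : ℝ) * N * M := mul_le_mul_of_nonneg_right h3 hM

/-- [folklore] The block mean of a bounded function is bounded by the same constant (`1 ≤ N`). -/
theorem abs_blockMeanAt_le {N : ℕ} (hN : 1 ≤ N) {f : Form0 (d + 1) ℝ} {B : ℝ} (hf : ∀ x, |f x| ≤ B) (x : Fin (d + 1) → ℤ) :
    |blockMeanAt N f x| ≤ B := by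
  have hcard : ((box (d + 1) N).card : ℝ) = (N : ℝ) ^ (d + 1) := by
    simp only [AffineAveraging.box, Fintype.card_piFinset, Finset.card_range, Finset.prod_const, Finset.card_univ, Fintype.card_fin]
    push_cast; ring
  have hNpos : (0 : ℝ) < (N : ℝ) ^ (d + 1) := by positivity
  simp only [blockMeanAt, blockSum]
  rw [abs_div, abs_of_pos hNpos, div_le_iff₀ hNpos]
  calc |∑ b ∈ box (d + 1) N, f ((N : ℤ) • blk N x + toSite b)| ≤ ∑ b ∈ box (d + 1) N, |f ((N : ℤ) • blk N x + toSite b)| :=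
        Finset.abs_sum_le_sum_abs _ _
    _ ≤ ∑ _b ∈ box (d + 1) N, B := Finset.sum_le_sum fun b _ => hf _
    _ = B * (N : ℝ) ^ (d + 1) := by rw [Finset.sum_const, nsmul_eq_mul, hcard, mul_comm]

/-- [folklore] **THE BLOCK-MEAN TREE GAUGE OF A BOUNDED FORM IS BOUNDED**: `|bmGaugeAt ρ A N x| ≤ 2·(d+1)·N·M`. -/
theorem abs_bmGaugeAt_le {N : ℕ} (hN : 1 ≤ N) {r : Fin (d + 1) → ℕ} (hr : r ∈ box (d + 1) N) {A : Form1 (d + 1) ℝ} {M : ℝ} (hA : ∀ κ w, |A κ w| ≤ M)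
    (x : Fin (d + 1) → ℤ) : |bmGaugeAt (toSite r) A N x| ≤ 2 * ((((d + 1 : ℕ) : ℝ)) * N * M) := by
  have h1 := abs_treeGaugeAt_le hN hr hA x
  have h2 := abs_blockMeanAt_le hN (f := treeGaugeAt (toSite r) A N) (fun x' => abs_treeGaugeAt_le hN hr hA x') x
  simp only [bmGaugeAt, Pi.sub_apply]
  calc |treeGaugeAt (toSite r) A N x - blockMeanAt N (treeGaugeAt (toSite r) A N) x|
      ≤ |treeGaugeAt (toSite r) A N x| + |blockMeanAt N (treeGaugeAt (toSite r) A N) x| := abs_sub _ _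
    _ ≤ _ := by linarith

/-- [folklore] **A `LocStencil` LEG IS SUMMABLE IN ITS BOND SLOT** (rate `> 0`): `u ↦ S κ u x z a b` is summable. -/
theorem summable_stencil_slot {S : Fin (d + 1) → (Fin (d + 1) → ℤ) → MKer (d + 1) (Fib d)} {Cs δ : ℝ} (hS : LocStencil S Cs δ) (hδ : 0 < δ)
    (κ : Fin (d + 1)) (x z : Fin (d + 1) → ℤ) (a b : Fib d) : Summable fun u : Fin (d + 1) → ℤ => S κ u x z a b := by
  have hCs : 0 ≤ Cs := (hS κ 0).nonneg (Sum.inl 0)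
  refine Summable.of_norm_bounded ((summable_exp_shift' hδ x).mul_left Cs) fun u => ?_
  rw [Real.norm_eq_abs]
  have h := hS κ u x z a b
  have hz : 0 ≤ δ * l1 (z - u) := mul_nonneg hδ.le (l1_nonneg _)
  calc |S κ u x z a b| ≤ Cs * Real.exp (-δ * (l1 (x - u) + l1 (z - u))) := h
    _ ≤ Cs * Real.exp (-δ * l1 (u - x)) := by
        refine mul_le_mul_of_nonneg_left (Real.exp_le_exp.2 ?_) hCs
        rw [l1_sub_symm u x]
        nlinarith

/-! ## §4 Lattice summation by parts -/

/-- [folklore] **SUMMATION BY PARTS**: for a bounded function `χ` and a slot-summable one-form `g`,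
`Σ_κ Σ'_u (χ(u + e_κ) − χ u) · g κ u = −Σ'_u χ u · Σ_κ (g κ u − g κ (u − e_κ))`. -/
theorem sum_tsum_grad_mul_eq_neg_tsum_mul_div {χ : Form0 (d + 1) ℝ} {g : Form1 (d + 1) ℝ} {B : ℝ} (hχ : ∀ u, |χ u| ≤ B) (hg : ∀ κ, Summable (g κ)) :
    ∑ κ : Fin (d + 1), ∑' u : Fin (d + 1) → ℤ, (χ (u + unitVec κ) - χ u) * g κ u
      = -∑' u : Fin (d + 1) → ℤ, χ u * ∑ κ : Fin (d + 1), (g κ u - g κ (u - unitVec κ)) := by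
  -- summability of the pieces
  have hB : 0 ≤ B := (abs_nonneg _).trans (hχ 0)
  have hs1 : ∀ κ, Summable fun u : Fin (d + 1) → ℤ => χ u * g κ u := fun κ =>
    Summable.of_norm_bounded ((hg κ).abs.mul_left B) fun u => by
      rw [Real.norm_eq_abs, abs_mul]; exact mul_le_mul_of_nonneg_right (hχ u) (abs_nonneg _)
  have hs2 : ∀ κ, Summable fun u : Fin (d + 1) → ℤ => χ u * g κ (u - unitVec κ) := fun κ =>
    Summable.of_norm_bounded ((((Equiv.subRight (unitVec κ)).summable_iff).2 (hg κ)).abs.mul_left B) fun u => by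
      rw [Real.norm_eq_abs, abs_mul]; exact mul_le_mul_of_nonneg_right (hχ u) (abs_nonneg _)
  have hs3 : ∀ κ, Summable fun u : Fin (d + 1) → ℤ => χ (u + unitVec κ) * g κ u := fun κ =>
    Summable.of_norm_bounded ((hg κ).abs.mul_left B) fun u => by
      rw [Real.norm_eq_abs, abs_mul]; exact mul_le_mul_of_nonneg_right (hχ _) (abs_nonneg _)
  -- shift the first piece
  have eS : ∀ κ, ∑' u : Fin (d + 1) → ℤ, χ (u + unitVec κ) * g κ u = ∑' u : Fin (d + 1) → ℤ, χ u * g κ (u - unitVec κ) := by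
    intro κ
    have h := (Equiv.addRight (unitVec κ)).tsum_eq (fun u : Fin (d + 1) → ℤ => χ u * g κ (u - unitVec κ))
    simp only [Equiv.coe_addRight, add_sub_cancel_right] at h
    exact h
  have eL : ∀ κ, ∑' u : Fin (d + 1) → ℤ, (χ (u + unitVec κ) - χ u) * g κ u
      = (∑' u : Fin (d + 1) → ℤ, χ u * g κ (u - unitVec κ)) - ∑' u : Fin (d + 1) → ℤ, χ u * g κ u := by
    intro κ
    rw [← eS κ, ← (hs3 κ).tsum_sub (hs1 κ)]
    exact tsum_congr fun u => by ring
  rw [Finset.sum_congr rfl fun κ _ => eL κ, Finset.sum_congr rfl fun κ _ => ((hs2 κ).tsum_sub (hs1 κ)).symm,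
    ← Summable.tsum_finsetSum (fun κ _ => (hs2 κ).sub (hs1 κ)), ← tsum_neg]
  refine tsum_congr fun u => ?_
  rw [Finset.mul_sum, ← Finset.sum_neg_distrib]
  exact Finset.sum_congr rfl fun κ _ => by ring

/-! ## §5 The pairing identity: dressed vertex = undressed vertex + «χ × fine divergence of the leg» -/

/-- NOT IN PRINT; OUR BOOKKEEPING.  **THE CO-DRESSED VERTEX AGAINST A STENCIL LEG** (the OWNER's (W6) shape; in-block root, `1 ≤ N`, decaying `K`, `LocStencil` leg):
`vertexOfK (coDressKBmAt ρ N K) N S μ y x z a b = vertexOfK K N S μ y x z a b + Σ'_u χ u · Σ_κ (S κ u x z a b − S κ (u − e_κ) x z a b)`,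
`χ = bmGaugeAt ρ (colH K N μ y) N` — the block-mean tree gauge of the undressed column, UNDIFFERENTIATED, against the FINE DIVERGENCE of the leg in its bond slot.
On a Ward-transversal leg (`Σ_κ (S κ u − S κ (u − e_κ)) = 0`) the correction vanishes (PART 4's `coProjBmAtK_eq_self_of_divFree` read from the column side). -/
theorem vertexOfK_coDressKBmAt_eq {N : ℕ} (hN : 1 ≤ N) {r : Fin (d + 1) → ℕ} (hr : r ∈ box (d + 1) N) {K : MKer (d + 1) (Fib d)} {C δK : ℝ}
    (hK : Decays K C δK) (hδK : 0 < δK) {S : Fin (d + 1) → (Fin (d + 1) → ℤ) → MKer (d + 1) (Fib d)} {Cs δs : ℝ} (hS : LocStencil S Cs δs)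
    (hδs : 0 < δs) (μ : Fin (d + 1)) (y x z : Fin (d + 1) → ℤ) (a b : Fib d) :
    vertexOfK (coDressKBmAt (toSite r) N K) N S μ y x z a b = vertexOfK K N S μ y x z a b
      + ∑' u : Fin (d + 1) → ℤ, bmGaugeAt (toSite r) (colH K N μ y) N u * ∑ κ : Fin (d + 1), (S κ u x z a b - S κ (u - unitVec κ) x z a b) := by
  set χ : Form0 (d + 1) ℝ := bmGaugeAt (toSite r) (colH K N μ y) N with hχ
  -- the two vertices in `Σ_κ Σ'_u` form
  have eG : vertexOfK (coDressKBmAt (toSite r) N K) N S μ y x z a b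
      = ∑ κ : Fin (d + 1), ∑' u : Fin (d + 1) → ℤ, colH (coDressKBmAt (toSite r) N K) N μ y κ u * S κ u x z a b := rfl
  have eK : vertexOfK K N S μ y x z a b = ∑ κ : Fin (d + 1), ∑' u : Fin (d + 1) → ℤ, colH K N μ y κ u * S κ u x z a b := rfl
  -- bounds and summability
  have hC : 0 ≤ C := hK.nonneg (Sum.inl 0)
  have hcol : ∀ (κ : Fin (d + 1)) (w : Fin (d + 1) → ℤ), |colH K N μ y κ w| ≤ C := by
    intro κ w
    have h := abs_colH_le (N := N) hK μ y κ w
    have he : Real.exp (-δK * l1 (w - (N : ℤ) • y)) ≤ 1 := by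
      rw [Real.exp_le_one_iff]
      have := l1_nonneg (w - (N : ℤ) • y)
      nlinarith
    calc |colH K N μ y κ w| ≤ C * Real.exp (-δK * l1 (w - (N : ℤ) • y)) := h
      _ ≤ C * 1 := mul_le_mul_of_nonneg_left he hC
      _ = C := mul_one _
  have hχb : ∀ u, |χ u| ≤ 2 * ((((d + 1 : ℕ) : ℝ)) * N * C) := fun u => abs_bmGaugeAt_le hN hr hcol u
  have hg : ∀ κ : Fin (d + 1), Summable fun u : Fin (d + 1) → ℤ => S κ u x z a b := fun κ => summable_stencil_slot hS hδs κ x z a b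
  have hsK : ∀ κ : Fin (d + 1), Summable fun u : Fin (d + 1) → ℤ => colH K N μ y κ u * S κ u x z a b := by
    intro κ
    have hCs : 0 ≤ Cs := (hS κ 0).nonneg (Sum.inl 0)
    have hsum : Summable fun u : Fin (d + 1) → ℤ => colH K N μ y κ u :=
      summable_col_of_decays hK hδK ((N : ℤ) • y) (Sum.inl κ) (Sum.inr μ)
    refine Summable.of_norm_bounded (hsum.abs.mul_right Cs) fun u => ?_
    rw [Real.norm_eq_abs, abs_mul]
    refine mul_le_mul_of_nonneg_left ?_ (abs_nonneg _)
    have h := hS κ u x z a b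
    have he : Real.exp (-δs * (l1 (x - u) + l1 (z - u))) ≤ 1 := by
      rw [Real.exp_le_one_iff]
      have := l1_nonneg (x - u); have := l1_nonneg (z - u)
      nlinarith
    calc |S κ u x z a b| ≤ Cs * Real.exp (-δs * (l1 (x - u) + l1 (z - u))) := h
      _ ≤ Cs * 1 := mul_le_mul_of_nonneg_left he hCs
      _ = Cs := mul_one _
  have hsD : ∀ κ : Fin (d + 1), Summable fun u : Fin (d + 1) → ℤ => (χ (u + unitVec κ) - χ u) * S κ u x z a b := by
    intro κ
    have hB : 0 ≤ 2 * ((((d + 1 : ℕ) : ℝ)) * N * C) := by positivity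
    refine Summable.of_norm_bounded ((hg κ).abs.mul_left (2 * (2 * ((((d + 1 : ℕ) : ℝ)) * N * C)))) fun u => ?_
    rw [Real.norm_eq_abs, abs_mul]
    refine mul_le_mul_of_nonneg_right ?_ (abs_nonneg _)
    calc |χ (u + unitVec κ) - χ u| ≤ |χ (u + unitVec κ)| + |χ u| := abs_sub _ _
      _ ≤ _ := by linarith [hχb (u + unitVec κ), hχb u]
  -- rewrite the dressed column and split
  rw [eG, eK]
  have e1 : ∀ κ : Fin (d + 1), ∑' u : Fin (d + 1) → ℤ, colH (coDressKBmAt (toSite r) N K) N μ y κ u * S κ u x z a b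
      = (∑' u : Fin (d + 1) → ℤ, colH K N μ y κ u * S κ u x z a b) - ∑' u : Fin (d + 1) → ℤ, (χ (u + unitVec κ) - χ u) * S κ u x z a b := by
    intro κ
    rw [← (hsK κ).tsum_sub (hsD κ)]
    refine tsum_congr fun u => ?_
    rw [colH_coDressKBmAt_eq_sub_grad hN hr K μ y κ u]
    ring
  rw [Finset.sum_congr rfl fun κ _ => e1 κ, Finset.sum_sub_distrib,
    sum_tsum_grad_mul_eq_neg_tsum_mul_div (χ := χ) (g := fun κ u => S κ u x z a b) hχb hg]
  ring

end Summit.QuantumFields.BalabanUV.Beta.GAN24.CoDressedColumnPairing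

end
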